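import Literature.NumberTheory.Sieve.IwaniecAlmostPrimesRootExpSum
import HarnessLib

/-!
# Iwaniec (1978), §4: the dispersion identities for `∑_m B(x; m, N)²` — PROVED

H. Iwaniec, *Almost-primes represented by quadratic polynomials*, Invent. Math. **47** (1978)
171–188, §4, proof of Proposition 1 (pp. 181–183): "By definition of `B(x; m, N)`,
`B = ∑_{n<N,(n,m)=1} b_n |𝒜_{mn}| − (ρ(m)/m) x ∑ b_n ρ(n)/n` … `= ∑_{0<v<m, v²+1≡0 (m)} {∑_n b_n ∑_{k<x, k≡v (m), k²+1≡0 (n)} 1 − (x/m) Y(m)}` …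
for the sake of applying Cauchy–Schwarz again, we consider `𝓜(x; M, N) = ∑_m ∑_v {…}² = W − 2xV + x²U`."
Fourth file of the inline proof of Proposition 1
(`Literature.NumberTheory.Sieve.Iwaniec1978.proposition1`); pure counting, everything PROVED,
no named facts.

* `xcount X n m v = X_n(m, v) = #{1 ≤ k ≤ X : k ≡ v (m), n ∣ k² + 1}`, `ycount` (minus its
  expectation `(x/m) ρ(n)/n`), `evm` (`E(m, v) = ∑_n b_n Y_n(m, v)`);
  `congrCount_mul_eq_sum_xcount` (`|𝒜_{mn}| = ∑_{v root mod m} X_n(m, v)`, `(m, n) = 1`),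
  `bilinearB_eq_sum_evm` (`B(x; m, N) = ∑_v E(m, v)`), `sq_bilinearB_le`, `sum_sq_bilinearB_le`
  (Cauchy–Schwarz over the `ρ(m)` roots: `∑_m B² ≤ T 𝒟` if `ρ(m) ≤ T`,
  `𝒟 = ∑_m ∑_v E(m, v)²`);
* `tsum2`, `dispersion_eq_sum_sum` (`𝒟 = ∑_{n₁,n₂} b_{n₁} b_{n₂} T(n₁, n₂)`), `wsum`, `vsum`, `usum`,
  `tsum2_eq` — **the dispersion identity** `T(n₁, n₂) = W − x e₂ V(n₁) − x e₁ V(n₂) + x² e₁ e₂ U`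
  (`e_i = ρ(n_i)/n_i`; the paper's `W − 2xV + x²U` with the `m`-range `(m, n₁ n₂) = 1`);
* the **`(l, Θ)` coordinates** (p. 182, `k = v + ml`, `Θ = cm + v`): `wcount m n c` (roots `Θ`
  mod `mn` with `⌊Θ/m⌋ = c`, i.e. `c/n ≤ Θ/(mn) < (c+1)/n`), `congrCount_le_sum_wcount`,
  `sum_wcount_le_congrCount` — the two-sided sandwich
  `∑_{l < X/m} #{Θ : ⌊Θ/m⌋ = l mod n} ≤ |𝒜_{mn}| ≤ ∑_{l ≤ X/m} #{Θ : ⌊Θ/m⌋ = l mod n}` (the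
  boundary layer `l = ⌊X/m⌋` is where the paper replaces `(x − v)/l` by `x/l`); `wpair` and
  `le_sum_xcount_mul`, `sum_xcount_mul_le` — the same for `W` with pairs `(l₁, l₂)`;
* `sum_sum_range_comm`, `sum_sum_sum_range_comm`, `lt_div_add_one_iff`, `lt_div_iff_succ_mul_le` —
  interchanging `∑_m ∑_{l < L(m)}` into `∑_l ∑_{m : (l+θ)m ≤ X}`, the form in which Lemma 4
  (`IwaniecAlmostPrimesLemma4.lean`) applies to each window.

What is NOT here: the conversion of the `W`-counts `wpair` into Lemma-4 window counts with the
classes modulo `d₂ = (n₁,n₂)/((n₁,n₂), l₁ − l₂)` (the conditions (19)–(20) of p. 183), and the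
evaluations of `U, V, W` — the next files.

## References

* H. Iwaniec, Invent. Math. 47 (1978) 171–188, §4 pp. 181–183 (`IwaniecInventiones1978`).
* arXiv:1910.02885 (2019), §4.1 (the same decomposition for a general quadratic).
-/

noncomputable section

open Finset Real

namespace Literature.NumberTheory.Sieve.Iwaniec1978

/-! ### The local counts `X_n(m, v)` and the decomposition of `B(x; m, N)` over the roots mod `m` -/

/-- `X_n(m, v) = #{1 ≤ k ≤ X : k ≡ v (mod m), n ∣ k² + 1}` (p. 181, the innermost count in the
dispersion `W`). [cite: IwaniecInventiones1978, §4 p. 181] -/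
def xcount (X n m v : ℕ) : ℕ :=
  ((Finset.Icc 1 X).filter (fun k => k % m = v ∧ n ∣ k ^ 2 + 1)).card

/-- **`|𝒜_{mn}| = ∑_{v root mod m} X_n(m, v)`** for `(m, n) = 1`, `m ≥ 1`: split the `k ≤ x` with
`mn ∣ k² + 1` according to `v = k mod m`, a root of `v² + 1 ≡ 0 (mod m)`.
[cite: IwaniecInventiones1978, §4 p. 181] -/
theorem congrCount_mul_eq_sum_xcount (x : ℝ) {m n : ℕ} (hm : 0 < m) (hmn : m.Coprime n) :
    congrCount x (m * n) = ∑ v ∈ rootsNat m, xcount ⌊x⌋₊ n m v := by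
  classical
  unfold congrCount
  set X := ⌊x⌋₊
  have hmaps : ∀ k ∈ (Finset.Icc 1 X).filter (fun k : ℕ => m * n ∣ k ^ 2 + 1), k % m ∈ rootsNat m := by
    intro k hk
    rw [Finset.mem_filter] at hk
    rw [mem_rootsNat]
    refine ⟨Nat.mod_lt _ hm, ?_⟩
    have h1 : m ∣ k ^ 2 + 1 := (dvd_mul_right m n).trans hk.2
    have h2 : (k % m) ^ 2 + 1 ≡ k ^ 2 + 1 [MOD m] := ((Nat.mod_modEq k m).pow 2).add_right 1
    exact Nat.modEq_zero_iff_dvd.mp (h2.trans (Nat.modEq_zero_iff_dvd.mpr h1))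
  rw [Finset.card_eq_sum_card_fiberwise hmaps]
  refine Finset.sum_congr rfl fun v hv => ?_
  rw [mem_rootsNat] at hv
  unfold xcount
  rw [Finset.filter_filter]
  congr 1
  refine Finset.filter_congr fun k _ => ?_
  constructor
  · rintro ⟨h1, h2⟩
    exact ⟨h2, (dvd_mul_left n m).trans h1⟩
  · rintro ⟨h1, h2⟩
    refine ⟨hmn.mul_dvd_of_dvd_of_dvd ?_ h2, h1⟩
    have h3 : k ^ 2 + 1 ≡ (k % m) ^ 2 + 1 [MOD m] := ((Nat.mod_modEq k m).symm.pow 2).add_right 1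
    rw [h1] at h3
    exact Nat.modEq_zero_iff_dvd.mp (h3.trans (Nat.modEq_zero_iff_dvd.mpr hv.2))

/-- `Y_n(m, v) = X_n(m, v) − (x/m) ρ(n)/n` (p. 181: `X_n` minus its expected value).
[cite: IwaniecInventiones1978, §4 p. 181] -/
def ycount (x : ℝ) (n m v : ℕ) : ℝ :=
  (xcount ⌊x⌋₊ n m v : ℝ) - x * ((rho n : ℝ) / n) / m

/-- `E(m, v) = ∑_{n < N, (n,m)=1} b_n Y_n(m, v)`, so that `B(x; m, N) = ∑_{v root mod m} E(m, v)`.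
[cite: IwaniecInventiones1978, §4 p. 181] -/
def evm (x : ℝ) (b : ℕ → ℝ) (N : ℝ) (m v : ℕ) : ℝ :=
  ∑ n ∈ (Finset.Ico 1 ⌈N⌉₊).filter (fun n : ℕ => n.Coprime m), b n * ycount x n m v

/-- **`B(x; m, N) = ∑_{v root mod m} E(m, v)`** (`m ≥ 1`). [cite: IwaniecInventiones1978, §4 p. 181] -/
theorem bilinearB_eq_sum_evm (x : ℝ) (b : ℕ → ℝ) (N : ℝ) {m : ℕ} (hm : 0 < m) :
    bilinearB x b m N = ∑ v ∈ rootsNat m, evm x b N m v := by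
  unfold bilinearB evm
  rw [Finset.sum_comm]
  refine Finset.sum_congr rfl fun n hn => ?_
  rw [Finset.mem_filter, Finset.mem_Ico] at hn
  have hn0 : 0 < n := hn.1.1
  have hmn : m.Coprime n := hn.2.symm
  rw [← Finset.mul_sum]
  congr 1
  unfold rem ycount
  rw [Finset.sum_sub_distrib, ← Nat.cast_sum, ← congrCount_mul_eq_sum_xcount x hm hmn,
    Finset.sum_const, card_rootsNat, nsmul_eq_mul, rho_mul_of_coprime hm.ne' hn0.ne' hmn]
  have hm0 : (m : ℝ) ≠ 0 := by exact_mod_cast hm.ne'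
  have hn0' : (n : ℝ) ≠ 0 := by exact_mod_cast hn0.ne'
  push_cast
  field_simp

/-- **Cauchy–Schwarz over the roots mod `m`**: `B(x; m, N)² ≤ ρ(m) ∑_v E(m, v)²`.
[cite: IwaniecInventiones1978, §4 p. 181] -/
theorem sq_bilinearB_le (x : ℝ) (b : ℕ → ℝ) (N : ℝ) {m : ℕ} (hm : 0 < m) :
    bilinearB x b m N ^ 2 ≤ (rho m : ℝ) * ∑ v ∈ rootsNat m, evm x b N m v ^ 2 := by
  rw [bilinearB_eq_sum_evm x b N hm, ← card_rootsNat]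
  exact sq_sum_le_card_mul_sum_sq

/-- **`∑_m B(x; m, N)² ≤ T · 𝒟`** where `ρ(m) ≤ T` on the range and
`𝒟 = ∑_m ∑_{v root mod m} E(m, v)²` is the dispersion. [cite: IwaniecInventiones1978, §4 p. 181] -/
theorem sum_sq_bilinearB_le (x : ℝ) (b : ℕ → ℝ) (N : ℝ) {Ms : Finset ℕ} (hMs : ∀ m ∈ Ms, 0 < m)
    {T : ℝ} (hT : ∀ m ∈ Ms, (rho m : ℝ) ≤ T) :
    ∑ m ∈ Ms, bilinearB x b m N ^ 2 ≤ T * ∑ m ∈ Ms, ∑ v ∈ rootsNat m, evm x b N m v ^ 2 := by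
  rw [Finset.mul_sum]
  refine Finset.sum_le_sum fun m hm => ?_
  refine (sq_bilinearB_le x b N (hMs m hm)).trans ?_
  exact mul_le_mul_of_nonneg_right (hT m hm) (Finset.sum_nonneg fun _ _ => sq_nonneg _)

/-! ### Expanding the square: the dispersion as a double sum over `n₁, n₂` -/

/-- `T(n₁, n₂) = ∑_{m, (m, n₁ n₂) = 1} ∑_{v root mod m} Y_{n₁}(m, v) Y_{n₂}(m, v)`.
[cite: IwaniecInventiones1978, §4 p. 181] -/
def tsum2 (x : ℝ) (Ms : Finset ℕ) (n₁ n₂ : ℕ) : ℝ :=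
  ∑ m ∈ Ms.filter (fun m : ℕ => n₁.Coprime m ∧ n₂.Coprime m),
    ∑ v ∈ rootsNat m, ycount x n₁ m v * ycount x n₂ m v

/-- **`𝒟 = ∑_{n₁, n₂ < N} b_{n₁} b_{n₂} T(n₁, n₂)`.** [cite: IwaniecInventiones1978, §4 p. 181] -/
theorem dispersion_eq_sum_sum (x : ℝ) (b : ℕ → ℝ) (N : ℝ) (Ms : Finset ℕ) :
    ∑ m ∈ Ms, ∑ v ∈ rootsNat m, evm x b N m v ^ 2 =
      ∑ n₁ ∈ Finset.Ico 1 ⌈N⌉₊, ∑ n₂ ∈ Finset.Ico 1 ⌈N⌉₊, b n₁ * b n₂ * tsum2 x Ms n₁ n₂ := by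
  classical
  set Nall := Finset.Ico 1 ⌈N⌉₊ with hNall
  -- expand the square with indicators of the coprimality conditions
  have hsq : ∀ m v, evm x b N m v ^ 2 =
      ∑ n₁ ∈ Nall, ∑ n₂ ∈ Nall, (if n₁.Coprime m ∧ n₂.Coprime m then
        b n₁ * b n₂ * (ycount x n₁ m v * ycount x n₂ m v) else 0) := by
    intro m v
    unfold evm
    rw [sq, Finset.sum_mul_sum, Finset.sum_filter]
    refine Finset.sum_congr rfl fun n₁ _ => ?_
    rw [Finset.sum_filter]
    by_cases h1 : n₁.Coprime m
    · rw [if_pos h1]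
      refine Finset.sum_congr rfl fun n₂ _ => ?_
      by_cases h2 : n₂.Coprime m
      · rw [if_pos h2, if_pos ⟨h1, h2⟩]; ring
      · rw [if_neg h2, if_neg (fun h => h2 h.2)]
    · rw [if_neg h1]
      symm
      refine Finset.sum_eq_zero fun n₂ _ => ?_
      rw [if_neg (fun h => h1 h.1)]
  set F : ℕ → ℕ → ℕ → ℕ → ℝ := fun m v n₁ n₂ => if n₁.Coprime m ∧ n₂.Coprime m then
        b n₁ * b n₂ * (ycount x n₁ m v * ycount x n₂ m v) else 0 with hF
  have hsq' : ∀ m v, evm x b N m v ^ 2 = ∑ n₁ ∈ Nall, ∑ n₂ ∈ Nall, F m v n₁ n₂ := hsq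
  simp_rw [hsq']
  calc ∑ m ∈ Ms, ∑ v ∈ rootsNat m, ∑ n₁ ∈ Nall, ∑ n₂ ∈ Nall, F m v n₁ n₂
      = ∑ m ∈ Ms, ∑ n₁ ∈ Nall, ∑ v ∈ rootsNat m, ∑ n₂ ∈ Nall, F m v n₁ n₂ :=
        Finset.sum_congr rfl fun m _ => Finset.sum_comm
    _ = ∑ n₁ ∈ Nall, ∑ m ∈ Ms, ∑ v ∈ rootsNat m, ∑ n₂ ∈ Nall, F m v n₁ n₂ := Finset.sum_comm
    _ = ∑ n₁ ∈ Nall, ∑ m ∈ Ms, ∑ n₂ ∈ Nall, ∑ v ∈ rootsNat m, F m v n₁ n₂ :=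
        Finset.sum_congr rfl fun n₁ _ => Finset.sum_congr rfl fun m _ => Finset.sum_comm
    _ = ∑ n₁ ∈ Nall, ∑ n₂ ∈ Nall, ∑ m ∈ Ms, ∑ v ∈ rootsNat m, F m v n₁ n₂ :=
        Finset.sum_congr rfl fun n₁ _ => Finset.sum_comm
    _ = ∑ n₁ ∈ Nall, ∑ n₂ ∈ Nall, b n₁ * b n₂ * tsum2 x Ms n₁ n₂ := by
        refine Finset.sum_congr rfl fun n₁ _ => Finset.sum_congr rfl fun n₂ _ => ?_
        unfold tsum2
        rw [Finset.mul_sum, Finset.sum_filter]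
        refine Finset.sum_congr rfl fun m _ => ?_
        simp only [hF]
        by_cases hc : n₁.Coprime m ∧ n₂.Coprime m
        · simp only [if_pos hc, Finset.mul_sum]
        · simp only [if_neg hc, Finset.sum_const_zero]

/-! ### `T = W − x e₂ V₁ − x e₁ V₂ + x² e₁ e₂ U` -/

/-- `W(n₁, n₂) = ∑_m ∑_{v root mod m} X_{n₁}(m, v) X_{n₂}(m, v)` (p. 183).
[cite: IwaniecInventiones1978, §4 p. 183] -/
def wsum (X : ℕ) (Msf : Finset ℕ) (n₁ n₂ : ℕ) : ℕ :=
  ∑ m ∈ Msf, ∑ v ∈ rootsNat m, xcount X n₁ m v * xcount X n₂ m v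

/-- `V(n) = ∑_m ∑_{v root mod m} X_n(m, v)/m` (p. 182). [cite: IwaniecInventiones1978, §4 p. 182] -/
def vsum (X : ℕ) (Msf : Finset ℕ) (n : ℕ) : ℝ :=
  ∑ m ∈ Msf, ∑ v ∈ rootsNat m, (xcount X n m v : ℝ) / m

/-- `U = ∑_m ρ(m)/m²` (p. 181). [cite: IwaniecInventiones1978, §4 p. 181] -/
def usum (Msf : Finset ℕ) : ℝ := ∑ m ∈ Msf, (rho m : ℝ) / (m : ℝ) ^ 2

/-- **The dispersion identity for one pair**: with `e_i = ρ(n_i)/n_i` and the `m`-range restricted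
to `(m, n₁) = (m, n₂) = 1`,
`T(n₁, n₂) = W − x e₂ V(n₁) − x e₁ V(n₂) + x² e₁ e₂ U` (p. 181, `𝓜 = W − 2xV + x²U`).
[cite: IwaniecInventiones1978, §4 p. 181] -/
theorem tsum2_eq (x : ℝ) (Ms : Finset ℕ) (n₁ n₂ : ℕ) :
    tsum2 x Ms n₁ n₂ =
      (wsum ⌊x⌋₊ (Ms.filter (fun m : ℕ => n₁.Coprime m ∧ n₂.Coprime m)) n₁ n₂ : ℝ)
        - x * ((rho n₂ : ℝ) / n₂) * vsum ⌊x⌋₊ (Ms.filter (fun m : ℕ => n₁.Coprime m ∧ n₂.Coprime m)) n₁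
        - x * ((rho n₁ : ℝ) / n₁) * vsum ⌊x⌋₊ (Ms.filter (fun m : ℕ => n₁.Coprime m ∧ n₂.Coprime m)) n₂
        + x ^ 2 * ((rho n₁ : ℝ) / n₁) * ((rho n₂ : ℝ) / n₂) *
          usum (Ms.filter (fun m : ℕ => n₁.Coprime m ∧ n₂.Coprime m)) := by
  set Msf := Ms.filter (fun m : ℕ => n₁.Coprime m ∧ n₂.Coprime m) with hMsf
  set e₁ : ℝ := (rho n₁ : ℝ) / n₁
  set e₂ : ℝ := (rho n₂ : ℝ) / n₂
  have hper : ∀ m ∈ Msf, ∑ v ∈ rootsNat m, ycount x n₁ m v * ycount x n₂ m v =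
      (∑ v ∈ rootsNat m, (xcount ⌊x⌋₊ n₁ m v * xcount ⌊x⌋₊ n₂ m v : ℕ) : ℝ)
        - x * e₂ * ∑ v ∈ rootsNat m, (xcount ⌊x⌋₊ n₁ m v : ℝ) / m
        - x * e₁ * ∑ v ∈ rootsNat m, (xcount ⌊x⌋₊ n₂ m v : ℝ) / m
        + x ^ 2 * e₁ * e₂ * ((rho m : ℝ) / (m : ℝ) ^ 2) := by
    intro m _
    have hterm : ∀ v ∈ rootsNat m, ycount x n₁ m v * ycount x n₂ m v =
        ((xcount ⌊x⌋₊ n₁ m v * xcount ⌊x⌋₊ n₂ m v : ℕ) : ℝ) - x * e₂ * ((xcount ⌊x⌋₊ n₁ m v : ℝ) / m)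
          - x * e₁ * ((xcount ⌊x⌋₊ n₂ m v : ℝ) / m) + x ^ 2 * e₁ * e₂ * (1 / (m : ℝ) ^ 2) := by
      intro v _
      unfold ycount
      push_cast
      ring
    rw [Finset.sum_congr rfl hterm, Finset.sum_add_distrib, Finset.sum_sub_distrib,
      Finset.sum_sub_distrib, ← Finset.mul_sum, ← Finset.mul_sum, ← Finset.mul_sum, Finset.sum_const,
      card_rootsNat, nsmul_eq_mul]
    push_cast
    ring
  unfold tsum2
  rw [← hMsf, Finset.sum_congr rfl hper, Finset.sum_add_distrib, Finset.sum_sub_distrib,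
    Finset.sum_sub_distrib, ← Finset.mul_sum, ← Finset.mul_sum, ← Finset.mul_sum]
  unfold wsum vsum usum
  push_cast
  ring

/-! ### The per-modulus sandwiches: `(l, Θ)` coordinates -/

/-- The window count `#{Θ root mod mn, 0 ≤ Θ < mn : ⌊Θ/m⌋ = c}`
(`= #{Θ : c/n ≤ Θ/(mn) < (c+1)/n}`). [cite: IwaniecInventiones1978, §4 p. 182] -/
def wcount (m n c : ℕ) : ℕ := ((rootsNat (m * n)).filter (fun Θ => Θ / m = c)).card

/-- Cardinality of a filtered product as an iterated sum. [folklore] -/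
theorem card_filter_product_eq_sum {α β : Type*} (s : Finset α) (t : Finset β) (R : α → β → Prop)
    [∀ a b, Decidable (R a b)] :
    ((s ×ˢ t).filter (fun p => R p.1 p.2)).card = ∑ a ∈ s, (t.filter (R a)).card := by
  classical
  rw [Finset.card_filter, Finset.sum_product]
  refine Finset.sum_congr rfl fun a _ => ?_
  rw [Finset.card_filter]

/-- **Upper sandwich for `V`**: `|𝒜_{mn}| ≤ ∑_{0 ≤ l ≤ X/m} #{Θ : ⌊Θ/m⌋ = l mod n}` — every
`k ≤ x` with `mn ∣ k² + 1` is `mn⌊l/n⌋ + Θ` with `l = ⌊k/m⌋ ≤ x/m`, `Θ = k mod mn` a root with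
`⌊Θ/m⌋ = l mod n`. [cite: IwaniecInventiones1978, §4 p. 182] -/
theorem congrCount_le_sum_wcount (x : ℝ) {m n : ℕ} (hm : 0 < m) (hn : 0 < n) :
    congrCount x (m * n) ≤ ∑ l ∈ Finset.range (⌊x⌋₊ / m + 1), wcount m n (l % n) := by
  classical
  set X := ⌊x⌋₊
  have hmn : 0 < m * n := Nat.mul_pos hm hn
  unfold congrCount wcount
  rw [← card_filter_product_eq_sum (Finset.range (X / m + 1)) (rootsNat (m * n))
    (fun l Θ => Θ / m = l % n)]
  refine Finset.card_le_card_of_injOn (fun k => (k / m, k % (m * n))) ?_ ?_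
  · intro k hk
    rw [Finset.mem_coe, Finset.mem_filter, Finset.mem_Icc] at hk
    rw [Finset.mem_coe, Finset.mem_filter, Finset.mem_product, Finset.mem_range, mem_rootsNat]
    refine ⟨⟨?_, Nat.mod_lt _ hmn, ?_⟩, ?_⟩
    · exact Nat.lt_succ_of_le (Nat.div_le_div_right hk.1.2)
    · have h2 : (k % (m * n)) ^ 2 + 1 ≡ k ^ 2 + 1 [MOD m * n] :=
        ((Nat.mod_modEq k (m * n)).pow 2).add_right 1
      exact Nat.modEq_zero_iff_dvd.mp (h2.trans (Nat.modEq_zero_iff_dvd.mpr hk.2))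
    · exact Nat.mod_mul_right_div_self k m n
  · intro k hk k' hk' h
    simp only [Prod.mk.injEq] at h
    obtain ⟨h1, h2⟩ := h
    have e1 : k % m = k' % m := by
      rw [← Nat.mod_mod_of_dvd k (dvd_mul_right m n), ← Nat.mod_mod_of_dvd k' (dvd_mul_right m n), h2]
    rw [← Nat.div_add_mod k m, ← Nat.div_add_mod k' m, h1, e1]

/-- **Lower sandwich for `V`**: `∑_{0 ≤ l < X/m} #{Θ : ⌊Θ/m⌋ = l mod n} ≤ |𝒜_{mn}|` for `m ≥ 2`
(`(l, Θ) ↦ k = mn⌊l/n⌋ + Θ ∈ [1, x]`). [cite: IwaniecInventiones1978, §4 p. 182] -/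
theorem sum_wcount_le_congrCount (x : ℝ) {m n : ℕ} (hm : 2 ≤ m) (hn : 0 < n) :
    ∑ l ∈ Finset.range (⌊x⌋₊ / m), wcount m n (l % n) ≤ congrCount x (m * n) := by
  classical
  set X := ⌊x⌋₊
  have hm0 : 0 < m := by omega
  have hmn : 0 < m * n := Nat.mul_pos hm0 hn
  unfold congrCount wcount
  rw [← card_filter_product_eq_sum (Finset.range (X / m)) (rootsNat (m * n))
    (fun l Θ => Θ / m = l % n)]
  refine Finset.card_le_card_of_injOn (fun p => p.2 + m * n * (p.1 / n)) ?_ ?_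
  · intro p hp
    rw [Finset.mem_coe, Finset.mem_filter, Finset.mem_product, Finset.mem_range, mem_rootsNat] at hp
    obtain ⟨⟨hl, hΘlt, hΘroot⟩, hdiv⟩ := hp
    rw [Finset.mem_coe, Finset.mem_filter, Finset.mem_Icc]
    -- `Θ ≥ 1` (a root modulo `mn ≥ 2` is nonzero)
    have hΘpos : 1 ≤ p.2 := by
      rcases Nat.eq_zero_or_pos p.2 with hz | hz
      · exfalso
        rw [hz] at hΘroot
        have h1 : m * n ∣ 1 := by simpa using hΘroot
        have := Nat.le_of_dvd one_pos h1
        nlinarith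
      · exact hz
    -- `k < m (l + 1) ≤ X`
    have hΘ' : p.2 < m * (p.1 % n) + m := by
      have e := Nat.div_add_mod p.2 m
      have hr := Nat.mod_lt p.2 hm0
      rw [hdiv] at e
      omega
    have e1 : m * n * (p.1 / n) + m * (p.1 % n) = m * p.1 := by
      rw [mul_assoc, ← mul_add, Nat.div_add_mod]
    have hkX : p.2 + m * n * (p.1 / n) ≤ X := by
      have h1 : p.2 + m * n * (p.1 / n) < m * (p.1 + 1) := by
        calc p.2 + m * n * (p.1 / n) < (m * (p.1 % n) + m) + m * n * (p.1 / n) :=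
              Nat.add_lt_add_right hΘ' _
          _ = m * (p.1 + 1) := by linarith [e1]
      have hl' : p.1 + 1 ≤ X / m := hl
      calc p.2 + m * n * (p.1 / n) ≤ m * (p.1 + 1) := h1.le
        _ ≤ m * (X / m) := Nat.mul_le_mul_left m hl'
        _ ≤ X := Nat.mul_div_le X m
    refine ⟨⟨le_trans hΘpos (Nat.le_add_right _ _), hkX⟩, ?_⟩
    -- root modulo `mn`
    have hmod : (p.2 + m * n * (p.1 / n)) % (m * n) = p.2 % (m * n) := Nat.add_mul_mod_self_left _ _ _
    have h2 : (p.2 + m * n * (p.1 / n)) ^ 2 + 1 ≡ p.2 ^ 2 + 1 [MOD m * n] :=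
      ((show p.2 + m * n * (p.1 / n) ≡ p.2 [MOD m * n] from hmod).pow 2).add_right 1
    exact Nat.modEq_zero_iff_dvd.mp (h2.trans (Nat.modEq_zero_iff_dvd.mpr hΘroot))
  · intro p hp p' hp' h
    rw [Finset.mem_coe, Finset.mem_filter, Finset.mem_product, Finset.mem_range, mem_rootsNat] at hp hp'
    simp only at h
    have hΘ : p.2 = p'.2 := by
      have e1 : (p.2 + m * n * (p.1 / n)) % (m * n) = p.2 := by
        rw [Nat.add_mul_mod_self_left, Nat.mod_eq_of_lt hp.1.2.1]
      have e2 : (p'.2 + m * n * (p'.1 / n)) % (m * n) = p'.2 := by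
        rw [Nat.add_mul_mod_self_left, Nat.mod_eq_of_lt hp'.1.2.1]
      rw [← e1, ← e2, h]
    have hq : p.1 / n = p'.1 / n := by
      have e1 : (p.2 + m * n * (p.1 / n)) / (m * n) = p.1 / n := by
        rw [Nat.add_mul_div_left _ _ hmn, Nat.div_eq_of_lt hp.1.2.1, zero_add]
      have e2 : (p'.2 + m * n * (p'.1 / n)) / (m * n) = p'.1 / n := by
        rw [Nat.add_mul_div_left _ _ hmn, Nat.div_eq_of_lt hp'.1.2.1, zero_add]
      rw [← e1, ← e2, h]
    have hl : p.1 = p'.1 := by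
      rw [← Nat.div_add_mod p.1 n, ← Nat.div_add_mod p'.1 n, hq, ← hp.2, ← hp'.2, hΘ]
    exact Prod.ext hl hΘ

/-- The `W`-count for fixed `(l₁, l₂)` and `m`:
`#{v root mod m : n₁ ∣ (v + m l₁)² + 1, n₂ ∣ (v + m l₂)² + 1}` (p. 183, the conditions (19)).
[cite: IwaniecInventiones1978, §4 p. 183] -/
def wpair (m n₁ n₂ l₁ l₂ : ℕ) : ℕ :=
  ((rootsNat m).filter (fun v => n₁ ∣ (v + m * l₁) ^ 2 + 1 ∧ n₂ ∣ (v + m * l₂) ^ 2 + 1)).card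

/-- `∑_v X_{n₁}(m,v) X_{n₂}(m,v)` counts the pairs `(k₁, k₂)` in a common root class mod `m`.
[folklore] -/
theorem sum_xcount_mul_eq_card (X m n₁ n₂ : ℕ) :
    ∑ v ∈ rootsNat m, xcount X n₁ m v * xcount X n₂ m v =
      (((Finset.Icc 1 X) ×ˢ (Finset.Icc 1 X)).filter (fun p : ℕ × ℕ => p.1 % m ∈ rootsNat m ∧
        p.2 % m = p.1 % m ∧ n₁ ∣ p.1 ^ 2 + 1 ∧ n₂ ∣ p.2 ^ 2 + 1)).card := by
  classical
  unfold xcount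
  have hprod : ∀ v ∈ rootsNat m,
      ((Finset.Icc 1 X).filter (fun k => k % m = v ∧ n₁ ∣ k ^ 2 + 1)).card *
        ((Finset.Icc 1 X).filter (fun k => k % m = v ∧ n₂ ∣ k ^ 2 + 1)).card =
      (((Finset.Icc 1 X).filter (fun k => k % m = v ∧ n₁ ∣ k ^ 2 + 1)) ×ˢ
        ((Finset.Icc 1 X).filter (fun k => k % m = v ∧ n₂ ∣ k ^ 2 + 1))).card := by
    intro v _; rw [Finset.card_product]
  rw [Finset.sum_congr rfl hprod, ← Finset.card_biUnion]
  · congr 1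
    ext p
    simp only [Finset.mem_biUnion, Finset.mem_product, Finset.mem_filter]
    constructor
    · rintro ⟨v, hv, ⟨h1, h1m, h1n⟩, h2, h2m, h2n⟩
      exact ⟨⟨h1, h2⟩, h1m ▸ hv, by rw [h2m, h1m], h1n, h2n⟩
    · rintro ⟨⟨h1, h2⟩, hv, h21, h1n, h2n⟩
      exact ⟨p.1 % m, hv, ⟨h1, rfl, h1n⟩, h2, h21, h2n⟩
  · intro v _ v' _ hne
    simp only [Function.onFun]
    rw [Finset.disjoint_left]
    intro q hq hq'
    rw [Finset.mem_product, Finset.mem_filter, Finset.mem_filter] at hq hq'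
    exact hne (hq.1.2.1.symm.trans hq'.1.2.1)

/-- Cardinality of a filtered triple product as a double iterated sum. [folklore] -/
theorem card_filter_product_product_eq_sum {α β γ : Type*} (s : Finset α) (t : Finset β)
    (u : Finset γ) (R : α → β → γ → Prop) [∀ a b c, Decidable (R a b c)] :
    (((s ×ˢ t) ×ˢ u).filter (fun p => R p.1.1 p.1.2 p.2)).card =
      ∑ a ∈ s, ∑ b ∈ t, (u.filter (R a b)).card := by
  classical
  rw [card_filter_product_eq_sum (s ×ˢ t) u (fun ab c => R ab.1 ab.2 c), Finset.sum_product]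

/-- **Upper sandwich for `W`**: `∑_v X₁X₂ ≤ ∑_{l₁, l₂ ≤ X/m} wpair(m; l₁, l₂)`
(`(k₁, k₂) ↦ (⌊k₁/m⌋, ⌊k₂/m⌋, k₁ mod m)`). [cite: IwaniecInventiones1978, §4 p. 183] -/
theorem sum_xcount_mul_le (X m n₁ n₂ : ℕ) :
    ∑ v ∈ rootsNat m, xcount X n₁ m v * xcount X n₂ m v ≤
      ∑ l₁ ∈ Finset.range (X / m + 1), ∑ l₂ ∈ Finset.range (X / m + 1), wpair m n₁ n₂ l₁ l₂ := by
  classical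
  rw [sum_xcount_mul_eq_card]
  unfold wpair
  rw [← card_filter_product_product_eq_sum (Finset.range (X / m + 1)) (Finset.range (X / m + 1))
    (rootsNat m) (fun l₁ l₂ v => n₁ ∣ (v + m * l₁) ^ 2 + 1 ∧ n₂ ∣ (v + m * l₂) ^ 2 + 1)]
  refine Finset.card_le_card_of_injOn (fun p => ((p.1 / m, p.2 / m), p.1 % m)) ?_ ?_
  · intro p hp
    rw [Finset.mem_coe, Finset.mem_filter, Finset.mem_product, Finset.mem_Icc, Finset.mem_Icc] at hp
    obtain ⟨⟨h1, h2⟩, hv, h21, h1n, h2n⟩ := hp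
    rw [Finset.mem_coe, Finset.mem_filter, Finset.mem_product, Finset.mem_product, Finset.mem_range,
      Finset.mem_range]
    refine ⟨⟨⟨Nat.lt_succ_of_le (Nat.div_le_div_right h1.2),
      Nat.lt_succ_of_le (Nat.div_le_div_right h2.2)⟩, hv⟩, ?_, ?_⟩
    · simp only; rw [Nat.mod_add_div]; exact h1n
    · simp only; rw [← h21, Nat.mod_add_div]; exact h2n
  · intro p hp p' hp' h
    rw [Finset.mem_coe, Finset.mem_filter] at hp hp'
    simp only [Prod.mk.injEq] at h
    obtain ⟨⟨hd1, hd2⟩, hmod⟩ := h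
    have e1 : p.1 = p'.1 := by rw [← Nat.mod_add_div p.1 m, ← Nat.mod_add_div p'.1 m, hmod, hd1]
    have e2 : p.2 = p'.2 := by
      rw [← Nat.mod_add_div p.2 m, ← Nat.mod_add_div p'.2 m, hp.2.2.1, hp'.2.2.1, hmod, hd2]
    exact Prod.ext e1 e2

/-- **Lower sandwich for `W`** (`m ≥ 2`): `∑_{l₁, l₂ < X/m} wpair(m; l₁, l₂) ≤ ∑_v X₁X₂`
(`(l₁, l₂, v) ↦ (v + m l₁, v + m l₂)`). [cite: IwaniecInventiones1978, §4 p. 183] -/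
theorem le_sum_xcount_mul (X : ℕ) {m : ℕ} (hm : 2 ≤ m) (n₁ n₂ : ℕ) :
    ∑ l₁ ∈ Finset.range (X / m), ∑ l₂ ∈ Finset.range (X / m), wpair m n₁ n₂ l₁ l₂ ≤
      ∑ v ∈ rootsNat m, xcount X n₁ m v * xcount X n₂ m v := by
  classical
  have hm0 : 0 < m := by omega
  rw [sum_xcount_mul_eq_card]
  unfold wpair
  rw [← card_filter_product_product_eq_sum (Finset.range (X / m)) (Finset.range (X / m))
    (rootsNat m) (fun l₁ l₂ v => n₁ ∣ (v + m * l₁) ^ 2 + 1 ∧ n₂ ∣ (v + m * l₂) ^ 2 + 1)]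
  refine Finset.card_le_card_of_injOn (fun t => (t.2 + m * t.1.1, t.2 + m * t.1.2)) ?_ ?_
  · intro t ht
    rw [Finset.mem_coe, Finset.mem_filter, Finset.mem_product, Finset.mem_product, Finset.mem_range,
      Finset.mem_range, mem_rootsNat] at ht
    obtain ⟨⟨⟨hl1, hl2⟩, hvlt, hvroot⟩, h1n, h2n⟩ := ht
    have hvpos : 1 ≤ t.2 := by
      rcases Nat.eq_zero_or_pos t.2 with hz | hz
      · exfalso
        rw [hz] at hvroot
        have h1 : m ∣ 1 := by simpa using hvroot
        have := Nat.le_of_dvd one_pos h1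
        omega
      · exact hz
    have hbound : ∀ l, l < X / m → t.2 + m * l ≤ X := by
      intro l hl
      have hl' : l + 1 ≤ X / m := hl
      calc t.2 + m * l ≤ m + m * l := by omega
        _ = m * (l + 1) := by ring
        _ ≤ m * (X / m) := Nat.mul_le_mul_left m hl'
        _ ≤ X := Nat.mul_div_le X m
    have hmod : ∀ l, (t.2 + m * l) % m = t.2 := by
      intro l; rw [Nat.add_mul_mod_self_left, Nat.mod_eq_of_lt hvlt]
    rw [Finset.mem_coe, Finset.mem_filter, Finset.mem_product, Finset.mem_Icc, Finset.mem_Icc]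
    simp only
    refine ⟨⟨⟨le_trans hvpos (Nat.le_add_right _ _), hbound _ hl1⟩,
      ⟨le_trans hvpos (Nat.le_add_right _ _), hbound _ hl2⟩⟩, ?_, ?_, h1n, h2n⟩
    · rw [hmod, mem_rootsNat]; exact ⟨hvlt, hvroot⟩
    · rw [hmod, hmod]
  · intro t ht t' ht' h
    rw [Finset.mem_coe, Finset.mem_filter, Finset.mem_product, Finset.mem_product, Finset.mem_range,
      Finset.mem_range, mem_rootsNat] at ht ht'
    simp only [Prod.mk.injEq] at h
    obtain ⟨h1, h2⟩ := h
    have hv : t.2 = t'.2 := by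
      have e := congrArg (· % m) h1
      simp only [Nat.add_mul_mod_self_left, Nat.mod_eq_of_lt ht.1.2.1,
        Nat.mod_eq_of_lt ht'.1.2.1] at e
      exact e
    rw [hv] at h1 h2
    have hl1 : t.1.1 = t'.1.1 := Nat.eq_of_mul_eq_mul_left hm0 (Nat.add_left_cancel h1)
    have hl2 : t.1.2 = t'.1.2 := Nat.eq_of_mul_eq_mul_left hm0 (Nat.add_left_cancel h2)
    exact Prod.ext (Prod.ext hl1 hl2) hv

/-! ### Interchanging the `m`- and `l`-summations -/

/-- `∑_{m} ∑_{l < L(m)} f = ∑_{l < L_max} ∑_{m : l < L(m)} f` when `L(m) ≤ L_max`. [folklore] -/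
theorem sum_sum_range_comm {M : Type*} [AddCommMonoid M] (s : Finset ℕ) (L : ℕ → ℕ) {Lmax : ℕ}
    (hL : ∀ m ∈ s, L m ≤ Lmax) (f : ℕ → ℕ → M) :
    ∑ m ∈ s, ∑ l ∈ Finset.range (L m), f m l =
      ∑ l ∈ Finset.range Lmax, ∑ m ∈ s.filter (fun m => l < L m), f m l := by
  classical
  have h1 : ∀ m ∈ s, ∑ l ∈ Finset.range (L m), f m l =
      ∑ l ∈ Finset.range Lmax, if l < L m then f m l else 0 := by
    intro m hm
    rw [← Finset.sum_filter]
    congr 1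
    ext l
    simp only [Finset.mem_range, Finset.mem_filter]
    have := hL m hm
    omega
  rw [Finset.sum_congr rfl h1, Finset.sum_comm]
  refine Finset.sum_congr rfl fun l _ => ?_
  rw [Finset.sum_filter]

/-- The double version: `∑_m ∑_{l₁, l₂ < L(m)} f = ∑_{l₁, l₂ < L_max} ∑_{m : l₁, l₂ < L(m)} f`.
[folklore] -/
theorem sum_sum_sum_range_comm {M : Type*} [AddCommMonoid M] (s : Finset ℕ) (L : ℕ → ℕ)
    {Lmax : ℕ} (hL : ∀ m ∈ s, L m ≤ Lmax) (f : ℕ → ℕ → ℕ → M) :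
    ∑ m ∈ s, ∑ l₁ ∈ Finset.range (L m), ∑ l₂ ∈ Finset.range (L m), f m l₁ l₂ =
      ∑ l₁ ∈ Finset.range Lmax, ∑ l₂ ∈ Finset.range Lmax,
        ∑ m ∈ s.filter (fun m => l₁ < L m ∧ l₂ < L m), f m l₁ l₂ := by
  classical
  rw [sum_sum_range_comm s L hL]
  refine Finset.sum_congr rfl fun l₁ _ => ?_
  rw [sum_sum_range_comm (s.filter (fun m => l₁ < L m)) L (fun m hm => hL m (Finset.mem_filter.mp hm).1)]
  refine Finset.sum_congr rfl fun l₂ _ => ?_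
  rw [Finset.filter_filter]

/-- `l < X/m + 1 ⇔ l m ≤ X` (`m ≥ 1`). [folklore] -/
theorem lt_div_add_one_iff {X m l : ℕ} (hm : 0 < m) : l < X / m + 1 ↔ l * m ≤ X := by
  rw [Nat.lt_succ_iff, Nat.le_div_iff_mul_le hm]

/-- `l < X/m ⇔ (l + 1) m ≤ X` (`m ≥ 1`). [folklore] -/
theorem lt_div_iff_succ_mul_le {X m l : ℕ} (hm : 0 < m) : l < X / m ↔ (l + 1) * m ≤ X := by
  rw [← Nat.le_div_iff_mul_le hm]; omega

end Literature.NumberTheory.Sieve.Iwaniec1978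

end
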